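import Summits.QuantumAdvantage.AdviceFreeQNC0.FixedBellsGap
import Summits.QuantumAdvantage.AdviceFreeQNC0.RingHardOdd
import HarnessLib

/-!
# Cell qa-qnc0 (rung F-Q2-odd, `p = 3`): R0, sparse branch — at most 20 fixed bells (ROUND-15 §9.7 (iv))

Planner qa-qnc0-p1 g17, route DWalkThree, support `RingFixedBellsSharp3` (stmt-QuantumAdvantage-22487), sparse half:
a FIXED bell set `B ⊆ Fin N` with `#B ≤ 20` wins the ring game on at most `(2·2^{N-1} + 2^{N - ⌊(N-20)/21⌋})/3`
odd-class inputs.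

* `fixedBellsInnerGap3_one` — the tree's `fixedBellsInnerGap3` with its constant made explicit (`c = 1`):
  `3·2^m·#WIN ≤ (2^m + 1)·2^N` for a bell-free run of `m` cuts (same proof: `CleanGapStrategies.ringWinU_cleanGap_le`
  transported by `WalkTransport.rel_iff_ringWinU`);
* `exists_bellfree_run` — pigeonhole: `b` bells leave a run of `⌊(N-b)/(b+1)⌋` consecutive bell-free cuts;
* **`fixedBells_sparse_le`** — the bound above.

WHAT THIS IS NOT: the dense half (`≥ 21` bells, transfer matrices) is `TransferWalk.lean`; separation NOT moved.
-/

noncomputable section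

namespace Summit.QuantumAdvantage.AdviceFreeQNC0

open Finset Literature.Computability.QuantumComplexity Literature.Computability.QuantumComplexity.RingHLF
open Literature.Computability.MetaComplexity

/-- **R0-sparse with explicit constant**: `3·2^m·#{x odd : Rel x (tGuess x ⊕ 1_B)} ≤ (2^m + 1)·2^N` whenever the cuts
`a … a+m-1` (`a + m ≤ N`) carry no bell.  (Proof = the tree's `fixedBellsInnerGap3`, constant exposed.) -/
theorem fixedBellsInnerGap3_one (N m : ℕ) (hN : 3 ≤ N) (hm : m + 1 ≤ N) (B : Finset (Fin N))
    (hB : ∃ a : ℕ, a + m ≤ N ∧ ∀ k : Fin N, (a ≤ k.val ∧ k.val < a + m) → k ∉ B) :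
    3 * 2 ^ m * (univ.filter fun x : Fin N → Bool =>
        (univ.filter fun b : Fin N => x b = false).card % 2 = 1 ∧
          RingHLF.Rel x (fun k => xor (tGuess x k) (decide (k ∈ B)))).card ≤ (2 ^ m + 1) * 2 ^ N := by
  classical
  -- write `N = p + m + q + 1` with the window of `m` bits starting at bit `p = a - 1`
  obtain ⟨p, q, hpa, rfl⟩ : ∃ p q : ℕ, (∀ g : ℕ, p < g → g < p + m → ∃ a, (a ≤ g ∧ g < a + m) ∧
      ∀ k : Fin N, (a ≤ k.val ∧ k.val < a + m) → k ∉ B) ∧ N = p + m + q + 1 := by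
    obtain ⟨a, ham, hgapB⟩ := hB
    exact ⟨a - 1, N - 1 - (a - 1) - m, fun g h1 h2 => ⟨a, ⟨by omega, by omega⟩, hgapB⟩, by omega⟩
  -- the constant selector in u-coordinates and the gap lemma
  set y : Fin (p + m + q + 1) → (Fin (p + m + q) → Bool) → Bool := fun g _ => decide (g ∈ B) with hy
  have hgap : ∀ g : Fin (p + m + q + 1), p < g.val → g.val < p + m → ∀ w, y g w = false := by
    intro g h1 h2 w
    obtain ⟨a, hag, hgapB⟩ := hpa g.val h1 h2
    simp only [hy, decide_eq_false_iff_not]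
    exact hgapB g hag
  have hloc : ∀ (g : Fin (p + m + q + 1)) (a' : Fin p → Bool) (v v' : Fin m → Bool) (b : Fin q → Bool),
      y g (glue3 a' v b) = y g (glue3 a' v' b) := fun _ _ _ _ _ => rfl
  have hGap := ringWinU_cleanGap_le (p + m + q + 2) y hgap hloc
  -- the odd class injects into the walk wins of `y` (transport along `uVec`)
  set z : (Fin (p + m + q + 1) → Bool) → (Fin (p + m + q + 1) → Bool) :=
    fun x k => xor (tGuess x k) (decide (k ∈ B)) with hz
  have hy' : (fun (g : Fin (p + m + q + 1)) (u : Fin (p + m + q) → Bool) =>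
      xor (z (xOfU u) g) (tGuess (xOfU u) g)) = y := by
    funext g u
    simp only [hz, hy]
    generalize tGuess (xOfU u) g = t
    generalize decide (g ∈ B) = d
    cases t <;> cases d <;> rfl
  have hinj : (univ.filter fun x : Fin (p + m + q + 1) → Bool =>
        (univ.filter fun b : Fin (p + m + q + 1) => x b = false).card % 2 = 1 ∧ Rel x (z x)).card ≤
      (univ.filter fun w : Fin (p + m + q) → Bool => ringWinU (p + m + q + 2) y w = true).card := by
    refine Finset.card_le_card_of_injOn uVec ?_ ?_
    · intro x hx
      rw [Finset.mem_coe, mem_filter] at hx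
      rw [Finset.mem_coe, mem_filter]
      refine ⟨mem_univ _, ?_⟩
      have h := (rel_iff_ringWinU (by omega) x hx.2.1 z).1 hx.2.2
      rwa [hy'] at h
    · intro x₁ hx₁ x₂ hx₂ h
      rw [Finset.mem_coe, mem_filter] at hx₁ hx₂
      rw [← xOfU_uVec (by omega) x₁ hx₁.2.1, ← xOfU_uVec (by omega) x₂ hx₂.2.1, h]
  -- arithmetic: `2^m · (2·2ⁿ + 2·2^{p+q}) = (2^m + 1) · 2^{n+1}`
  have hpow : 2 ^ m * (2 * 2 ^ (p + m + q) + 2 * 2 ^ (p + q)) = (2 ^ m + 1) * 2 ^ (p + m + q + 1) := by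
    ring
  have h3 : 3 * 2 ^ m * (univ.filter fun x : Fin (p + m + q + 1) → Bool =>
          (univ.filter fun b : Fin (p + m + q + 1) => x b = false).card % 2 = 1 ∧ Rel x (z x)).card
      ≤ 2 ^ m * (3 * (univ.filter fun w : Fin (p + m + q) → Bool =>
          ringWinU (p + m + q + 2) y w = true).card) := by
    have := Nat.mul_le_mul_left (3 * 2 ^ m) hinj
    linarith
  calc 3 * 2 ^ m * (univ.filter fun x : Fin (p + m + q + 1) → Bool =>
          (univ.filter fun b : Fin (p + m + q + 1) => x b = false).card % 2 = 1 ∧ Rel x (z x)).card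
      ≤ 2 ^ m * (3 * (univ.filter fun w : Fin (p + m + q) → Bool =>
          ringWinU (p + m + q + 2) y w = true).card) := h3
    _ ≤ 2 ^ m * (2 * 2 ^ (p + m + q) + 2 * 2 ^ (p + q)) := Nat.mul_le_mul_left _ hGap
    _ = (2 ^ m + 1) * 2 ^ (p + m + q + 1) := hpow

/-- **Pigeonhole**: `b = #B` bells leave `⌊(N-b)/(b+1)⌋` consecutive bell-free cuts inside the cut range. -/
theorem exists_bellfree_run (N : ℕ) (B : Finset (Fin N)) :
    ∃ a : ℕ, a + (N - B.card) / (B.card + 1) ≤ N ∧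
      ∀ k : Fin N, (a ≤ k.val ∧ k.val < a + (N - B.card) / (B.card + 1)) → k ∉ B := by
  classical
  set b := B.card with hb
  set m := (N - b) / (b + 1) with hm
  have hbN : b ≤ N := by rw [hb]; exact le_trans (Finset.card_le_univ B) (by rw [Fintype.card_fin])
  have hmb : m * (b + 1) ≤ N - b := Nat.div_mul_le_self _ _
  -- the `b + 1` disjoint windows `[i(m+1), i(m+1) + m)`, `i ≤ b`, all fit
  have hfit : ∀ i, i ≤ b → i * (m + 1) + m ≤ N := by
    intro i hi
    have h1 : i * (m + 1) ≤ b * (m + 1) := Nat.mul_le_mul_right _ hi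
    have h2 : m * (b + 1) + b ≤ N := by omega
    calc i * (m + 1) + m ≤ b * (m + 1) + m := by omega
      _ = m * (b + 1) + b := by ring
      _ ≤ N := h2
  by_contra hcon
  have hcon' : ∀ i : Fin (b + 1), ∃ k : Fin N, (i.val * (m + 1) ≤ k.val ∧ k.val < i.val * (m + 1) + m) ∧ k ∈ B := by
    intro i
    by_contra h'
    exact hcon ⟨i.val * (m + 1), hfit i.val (by have := i.isLt; omega), fun k hk hkB => h' ⟨k, hk, hkB⟩⟩
  choose G hG using hcon'
  have hinj : Set.InjOn G ↑(univ : Finset (Fin (b + 1))) := by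
    intro i _ j _ hij
    have h1 := (hG i).1
    have h2 := (hG j).1
    rw [hij] at h1
    apply Fin.ext
    by_contra hne
    rcases Nat.lt_or_gt_of_ne hne with h | h
    · have : (i.val + 1) * (m + 1) ≤ j.val * (m + 1) := Nat.mul_le_mul_right _ h
      rw [Nat.add_mul, one_mul] at this
      omega
    · have : (j.val + 1) * (m + 1) ≤ i.val * (m + 1) := Nat.mul_le_mul_right _ h
      rw [Nat.add_mul, one_mul] at this
      omega
  have hle := Finset.card_le_card_of_injOn G (fun i _ => (hG i).2) hinj
  rw [card_univ, Fintype.card_fin] at hle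
  omega

open Classical in
/-- **R0, sparse branch**: for `#B ≤ 20`, `3·#{x odd : Rel x (tGuess x ⊕ 1_B)} ≤ 2·2^{N-1} + 2^{N - ⌊(N-20)/21⌋}`. -/
theorem fixedBells_sparse_le (N : ℕ) (hN : 3 ≤ N) (B : Finset (Fin N)) (hb : B.card ≤ 20) :
    3 * (univ.filter fun x : Fin N → Bool => OddZeros x ∧
        RingHLF.Rel x (fun k => xor (tGuess x k) (decide (k ∈ B)))).card ≤ 2 * 2 ^ (N - 1) + 2 ^ (N - (N - 20) / 21) := by
  classical
  set q := (N - 20) / 21 with hq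
  obtain ⟨a, ha, hfree⟩ := exists_bellfree_run N B
  have hmq : q ≤ (N - B.card) / (B.card + 1) := by
    rw [hq]
    calc (N - 20) / 21 ≤ (N - 20) / (B.card + 1) := Nat.div_le_div_left (by omega) (by omega)
      _ ≤ (N - B.card) / (B.card + 1) := Nat.div_le_div_right (by omega)
  have hqN : q + 1 ≤ N := by rw [hq]; omega
  have h := fixedBellsInnerGap3_one N q hN hqN B
    ⟨a, by omega, fun k hk => hfree k ⟨hk.1, by omega⟩⟩
  -- `(2^q + 1)·2^N = 2^q·(2^N + 2^{N-q})`
  have hqle : q ≤ N := by omega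
  have hsplit : (2 ^ q + 1) * 2 ^ N = 2 ^ q * (2 ^ N + 2 ^ (N - q)) := by
    have : 2 ^ N = 2 ^ q * 2 ^ (N - q) := by rw [← pow_add, Nat.add_sub_cancel' hqle]
    rw [Nat.mul_add, ← this]; ring
  have h2 : 2 ^ q * (3 * (univ.filter fun x : Fin N → Bool => OddZeros x ∧
      RingHLF.Rel x (fun k => xor (tGuess x k) (decide (k ∈ B)))).card) ≤ 2 ^ q * (2 ^ N + 2 ^ (N - q)) := by
    rw [← hsplit]
    calc 2 ^ q * (3 * (univ.filter fun x : Fin N → Bool => OddZeros x ∧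
          RingHLF.Rel x (fun k => xor (tGuess x k) (decide (k ∈ B)))).card)
        = 3 * 2 ^ q * (univ.filter fun x : Fin N → Bool =>
          (univ.filter fun b : Fin N => x b = false).card % 2 = 1 ∧
            RingHLF.Rel x (fun k => xor (tGuess x k) (decide (k ∈ B)))).card := by
          unfold OddZeros; ring
      _ ≤ (2 ^ q + 1) * 2 ^ N := h
  have h' := Nat.le_of_mul_le_mul_left h2 (by positivity)
  have hN1 : 2 * 2 ^ (N - 1) = 2 ^ N := by
    obtain ⟨N', rfl⟩ : ∃ N', N = N' + 1 := ⟨N - 1, by omega⟩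
    rw [Nat.add_sub_cancel, pow_succ]; ring
  rw [hN1]
  exact h'

end Summit.QuantumAdvantage.AdviceFreeQNC0

end
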